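import Literature.Geometry.Riemannian.MetricFlowFDistanceCouplingComparison
import Literature.Geometry.Riemannian.MetricFlowFDistanceTriangleFamily
import HarnessLib

/-!
# Convergence within the extended correspondence (Bamler 2023, §5.4, Lemma 5.20): auxiliary
# estimates (5.29)–(5.31)

R. Bamler, *Compactness theory of the space of super Ricci flows*, Invent. Math. 233 (2023), §5.4,
Lemma 5.20 (arXiv v1 Lemma 121), end of the proof ("It remains to show (5.28), i.e. that we have
convergence within `ℭ'`"): *"choose for any `i ≥ 1` and `t ∈ I ∖ Eⁱ` a coupling `q^{i,∞}_t` between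
`μⁱ_t, μ^∞_t` with the property that `∫ d^Z_t(φⁱ_t(xⁱ), φ^∞_t(x^∞)) dq^{i,∞}_t ≤ 2^{-i+1}`. For any
`i ≤ j` … use Lemma 2.2 to find a probability measure `q^{i,j,∞}` on `𝒳ⁱ_t × 𝒳ʲ_t × 𝒳^∞_t` whose
projection onto the first and last two factors equals `q^{i,∞}_t, q^{j,∞}_t`, respectively. Its
projection `q̃^{i,j}` onto the first two factors is a coupling between `μⁱ_t, μʲ_t` and …
`∫ d^Z_t(φⁱ_t(xⁱ), φʲ_t(xʲ)) dq̃^{i,j}_t ≤ 2^{-i+1} + 2^{-j+1}`. So by Lemma 5.19 … (5.29) …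
It follows that for any measurable subset `Y ⊂ 𝒳^∞_t` (5.30)
`∫_{𝒳ⁱ_t × Y} d_{W₁}^{Z_s}((φⁱ_s)_* νⁱ_{xⁱ;s}, (φ^∞_s)_* ν^∞_{x^∞;s}) dq^{i,∞}_t ≤ 2^{-i+3} +
∫_{𝒳ʲ_t × Y} d_{W₁}^{Z_s}((φʲ_s)_* νʲ_{xʲ;s}, (φ^∞_s)_* ν^∞_{x^∞;s}) dq^{j,∞}_t`. Next, suppose
that `Y` is compact and fix some `ε > 0`. We claim that for large `j` we have for any
`xʲ ∈ 𝒳ʲ_t`, `x^∞ ∈ Y` (5.31)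
`d_{W₁}^{Z_s}((φʲ_s)_* νʲ_{xʲ;s}, (φ^∞_s)_* ν^∞_{x^∞;s}) ≤ d^Z_t(φʲ_t(xʲ), φ^∞_t(x^∞)) + ε`."*

This file proves the ingredients of this argument in the tree's vocabulary
(`MetricFlowPair.kernelDistWithin`, `MetricFlow.FamilyCorrespondence`, `IsCoupling`,
`wassersteinW1`, lower Lebesgue integrals in `[0, ∞]`):

* `MetricFlowPair.kernelDistWithin_le_add_edist_add_edist` — the integrand of the `𝔽`-distance is
  `1`-Lipschitz in each variable (§3.2, Proposition (c));
* `MetricFlowPair.setLIntegral_kernelDistWithin_le_of_pair` — **(5.29)–(5.30)** for three members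
  of a family of `H`-concentrated metric flow pairs in one correspondence;
* `exists_forall_ge_forall_mem_le_of_isCompact` — functions `f_k ≥ 0` with
  `f_k(z) ≤ f_k(z') + L d(z, z')` converging to `0` pointwise converge uniformly on compact sets;
* `exists_forall_ge_kernel_le_edist_add` — the abstract form of **(5.31)**: kernels `K_k(y, z)`,
  `1`-Lipschitz in each variable, which tend to `0` along some sequence `φ_k(y_k) → φ_∞(z)` for
  every `z`, satisfy `K_k(y, z) ≤ d^Z(φ_k y, φ_∞ z) + ε` for large `k`, all `y` and all `z` in a
  compact set.

The choice of the couplings `q^{i,∞}_t` and the assembly of Lemma 5.20's convergence assertion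
(letting `j → ∞`, `ε → 0`, `Y ↑ 𝒳^∞_t`) are in `MetricFlowFLimitAdmissible.lean`.

## References

* R. H. Bamler, *Compactness theory of the space of super Ricci flows*, Invent. Math. 233 (2023),
  1121–1277 (arXiv:2008.09298), §5.4, Lemma 5.20 (arXiv v1 Lemma 121), (5.29)–(5.31); §5.3,
  Lemma 5.19; §3.2, Proposition (c); §2.1. [Bamler2023]
-/

noncomputable section

open Set MeasureTheory Filter TopologicalSpace Function
open scoped Topology ENNReal NNReal

namespace Literature.Geometry.Riemannian

universe u

namespace MetricFlowPair

open MetricFlow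

variable {I₁ I₂ : Set ℝ} {P₁ : MetricFlowPair.{u} I₁} {P₂ : MetricFlowPair.{u} I₂} {I'' : Set ℝ}

/-! ### The integrand is `1`-Lipschitz in each variable -/

/-- **The integrand of the `𝔽`-distance is `1`-Lipschitz in each variable** for `H`-concentrated
flows: for `s ≤ t` in `I''^{,1} ∩ I''^{,2}` and `p, q ∈ 𝒳¹_t × 𝒳²_t`,
`d_{W₁}((φ¹_s)_* ν¹_{p₁;s}, (φ²_s)_* ν²_{p₂;s}) ≤ d_{W₁}((φ¹_s)_* ν¹_{q₁;s}, (φ²_s)_* ν²_{q₂;s}) +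
d_t(p₁, q₁) + d_t(p₂, q₂)` — the `W₁`-triangle inequality between push-forwards under the isometric
embeddings `φ^i_s` (`wassersteinW1_map_triangle`) and `d_{W₁}(ν_{x;s}, ν_{y;s}) ≤ d_t(x, y)`
(Bamler 2023, §3.2, Proposition (c), `IsHConcentrated.wassersteinW1_condKernel_le_edist`); this is
the estimate "`≤ dʲ_t(xʲ, x'ʲ) + d_{W₁}(…) + d^∞_t(x'^∞, x^{∞,j})`" of the proof of (5.31).
[cite: Bamler2023, §5.4, Lemma 5.20 (arXiv v1 Lemma 121), proof of (5.31); §3.2, Proposition (c)] -/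
theorem kernelDistWithin_le_add_edist_add_edist {H₁ H₂ : ℝ} (hH₁ : P₁.flow.IsHConcentrated H₁)
    (hH₂ : P₂.flow.IsHConcentrated H₂) (ℭ : Correspondence₂ P₁.flow P₂.flow I'') {s t : ℝ}
    (hs₁ : s ∈ ℭ.dom₁) (hs₂ : s ∈ ℭ.dom₂) (ht₁ : t ∈ ℭ.dom₁) (ht₂ : t ∈ ℭ.dom₂) (hst : s ≤ t)
    (p q : P₁.flow.Slice ⟨t, (ℭ.dom₁_subset ht₁).1⟩ × P₂.flow.Slice ⟨t, (ℭ.dom₂_subset ht₂).1⟩) :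
    kernelDistWithin P₁ P₂ ℭ hs₁ hs₂ ht₁ ht₂ p ≤
      kernelDistWithin P₁ P₂ ℭ hs₁ hs₂ ht₁ ht₂ q + edist p.1 q.1 + edist p.2 q.2 := by
  haveI := P₁.flow.isProbabilityMeasure_condKernel (s := ⟨s, (ℭ.dom₁_subset hs₁).1⟩) p.1 hst
  haveI := P₁.flow.isProbabilityMeasure_condKernel (s := ⟨s, (ℭ.dom₁_subset hs₁).1⟩) q.1 hst
  haveI := P₂.flow.isProbabilityMeasure_condKernel (s := ⟨s, (ℭ.dom₂_subset hs₂).1⟩) p.2 hst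
  haveI := P₂.flow.isProbabilityMeasure_condKernel (s := ⟨s, (ℭ.dom₂_subset hs₂).1⟩) q.2 hst
  have hφ₁ := ℭ.isometry₁ s hs₁
  have hφ₂ := ℭ.isometry₂ s hs₂
  have hφ₁m : Measurable (ℭ.φ₁ s hs₁) := hφ₁.continuous.measurable
  have hφ₂m : Measurable (ℭ.φ₂ s hs₂) := hφ₂.continuous.measurable
  -- the two `W₁`-triangle inequalities in `Z_s`
  have h1 := wassersteinW1_map_triangle hφ₁ hφ₁ hφ₂
    (P₁.flow.condKernel p.1 ⟨s, (ℭ.dom₁_subset hs₁).1⟩)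
    (P₁.flow.condKernel q.1 ⟨s, (ℭ.dom₁_subset hs₁).1⟩)
    (P₂.flow.condKernel p.2 ⟨s, (ℭ.dom₂_subset hs₂).1⟩)
  have h2 := wassersteinW1_map_triangle hφ₁ hφ₂ hφ₂
    (P₁.flow.condKernel q.1 ⟨s, (ℭ.dom₁_subset hs₁).1⟩)
    (P₂.flow.condKernel q.2 ⟨s, (ℭ.dom₂_subset hs₂).1⟩)
    (P₂.flow.condKernel p.2 ⟨s, (ℭ.dom₂_subset hs₂).1⟩)
  -- the two outer terms are at most `d_t`
  have e1 : wassersteinW1 ((P₁.flow.condKernel p.1 ⟨s, (ℭ.dom₁_subset hs₁).1⟩).map (ℭ.φ₁ s hs₁))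
      ((P₁.flow.condKernel q.1 ⟨s, (ℭ.dom₁_subset hs₁).1⟩).map (ℭ.φ₁ s hs₁)) ≤ edist p.1 q.1 :=
    calc _ ≤ wassersteinW1 (P₁.flow.condKernel p.1 ⟨s, (ℭ.dom₁_subset hs₁).1⟩)
          (P₁.flow.condKernel q.1 ⟨s, (ℭ.dom₁_subset hs₁).1⟩) :=
          wassersteinW1_map_le_of_edist_le hφ₁m (fun a b ↦ (hφ₁.edist_eq a b).le) _ _
      _ ≤ edist p.1 q.1 := hH₁.wassersteinW1_condKernel_le_edist hst p.1 q.1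
  have e2 : wassersteinW1 ((P₂.flow.condKernel q.2 ⟨s, (ℭ.dom₂_subset hs₂).1⟩).map (ℭ.φ₂ s hs₂))
      ((P₂.flow.condKernel p.2 ⟨s, (ℭ.dom₂_subset hs₂).1⟩).map (ℭ.φ₂ s hs₂)) ≤ edist p.2 q.2 :=
    calc _ ≤ wassersteinW1 (P₂.flow.condKernel q.2 ⟨s, (ℭ.dom₂_subset hs₂).1⟩)
          (P₂.flow.condKernel p.2 ⟨s, (ℭ.dom₂_subset hs₂).1⟩) :=
          wassersteinW1_map_le_of_edist_le hφ₂m (fun a b ↦ (hφ₂.edist_eq a b).le) _ _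
      _ ≤ edist q.2 p.2 := hH₂.wassersteinW1_condKernel_le_edist hst q.2 p.2
      _ = edist p.2 q.2 := edist_comm _ _
  calc kernelDistWithin P₁ P₂ ℭ hs₁ hs₂ ht₁ ht₂ p
      ≤ _ := h1
    _ ≤ edist p.1 q.1 + (kernelDistWithin P₁ P₂ ℭ hs₁ hs₂ ht₁ ht₂ q + edist p.2 q.2) :=
        add_le_add e1 (h2.trans (add_le_add le_rfl e2))
    _ = kernelDistWithin P₁ P₂ ℭ hs₁ hs₂ ht₁ ht₂ q + edist p.1 q.1 + edist p.2 q.2 := by ring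

/-! ### (5.29)–(5.30): three members of a family in one correspondence -/

variable {ι : Type*} {I₀ : Set ℝ}

/-- **Bamler 2023, Lemma 5.20, (5.29)–(5.30)**: for three `H`-concentrated members `P a, P b, P c`
of a family of metric flow pairs in one correspondence `ℭ`, times `s ≤ t` of a set `J` over which
`ℭ.pair a b` is fully defined and which lie in `I''^{,c}`, couplings `q_a` of `μ^a_t, μ^c_t` and
`q_b` of `μ^b_t, μ^c_t`, and a measurable `Y ⊆ 𝒳^c_t`,
`∫_{𝒳^a_t × Y} d_{W₁}^{Z_s}((φ^a_s)_* ν^a_{x;s}, (φ^c_s)_* ν^c_{z;s}) dq_a ≤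
[∫ d^Z_t(φ^a_t x, φ^c_t z) dq_a + ∫ d^Z_t(φ^b_t y, φ^c_t z) dq_b + 2 d_𝔽^{ℭ,J}(P a, P b)] +
∫_{𝒳^b_t × Y} d_{W₁}^{Z_s}((φ^b_s)_* ν^b_{y;s}, (φ^c_s)_* ν^c_{z;s}) dq_b`. As printed: glue
`q_a` and `q_b` along `μ^c_t` (`IsCoupling.exists_glue`, Polish slices); the `(a, b)`-marginal
`q̃` of the glued measure couples `μ^a_t, μ^b_t` with
`∫ d^Z_t(φ^a_t x, φ^b_t y) dq̃ ≤ ∫ d^Z_t(φ^a_t x, φ^c_t z) dq_a + ∫ d^Z_t(φ^b_t y, φ^c_t z) dq_b`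
(triangle inequality in `Z_t`), so Lemma 5.19
(`lintegral_kernelDistWithin_le_add_two_mul_fDistWithin`) bounds `∫ d_{W₁}(…^a, …^b) dq̃`
(5.29); then the pointwise triangle inequality `kernelDistWithin_pair_le` in `Z_s` is integrated
over `𝒳^a_t × 𝒳^b_t × Y` against the glued measure (5.30) (integrands Borel by
`measurable_kernelDistWithin`).
[cite: Bamler2023, §5.4, Lemma 5.20 (arXiv v1 Lemma 121), (5.29)–(5.30)] -/
theorem setLIntegral_kernelDistWithin_le_of_pair (P : ι → MetricFlowPair.{u} I₀)
    (ℭ : FamilyCorrespondence (fun i ↦ (P i).flow) I'') {a b c : ι} {Ha Hb Hc : ℝ}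
    (hHa : (P a).flow.IsHConcentrated Ha) (hHb : (P b).flow.IsHConcentrated Hb)
    (hHc : (P c).flow.IsHConcentrated Hc) {J : Set ℝ} (hJ : (ℭ.pair a b).FullyDefinedOver J)
    {s t : ℝ} (hs : s ∈ J) (ht : t ∈ J) (hsc : s ∈ ℭ.dom c) (htc : t ∈ ℭ.dom c) (hst : s ≤ t)
    {qa : Measure ((P a).flow.Slice ⟨t, (ℭ.dom_subset a (hJ.1 ht)).1⟩ ×
      (P c).flow.Slice ⟨t, (ℭ.dom_subset c htc).1⟩)}
    {qb : Measure ((P b).flow.Slice ⟨t, (ℭ.dom_subset b (hJ.2 ht)).1⟩ ×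
      (P c).flow.Slice ⟨t, (ℭ.dom_subset c htc).1⟩)}
    (hqa : IsCoupling ((P a).μ ⟨t, (ℭ.dom_subset a (hJ.1 ht)).1⟩)
      ((P c).μ ⟨t, (ℭ.dom_subset c htc).1⟩) qa)
    (hqb : IsCoupling ((P b).μ ⟨t, (ℭ.dom_subset b (hJ.2 ht)).1⟩)
      ((P c).μ ⟨t, (ℭ.dom_subset c htc).1⟩) qb)
    {Y : Set ((P c).flow.Slice ⟨t, (ℭ.dom_subset c htc).1⟩)} (hY : MeasurableSet Y) :
    ∫⁻ p in Prod.snd ⁻¹' Y, kernelDistWithin (P a) (P c) (ℭ.pair a c) (hJ.1 hs) hsc (hJ.1 ht) htc p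
        ∂qa ≤
      ∫⁻ p, edist (ℭ.φ a t (hJ.1 ht) p.1) (ℭ.φ c t htc p.2) ∂qa +
        ∫⁻ p, edist (ℭ.φ b t (hJ.2 ht) p.1) (ℭ.φ c t htc p.2) ∂qb +
        2 * fDistWithin (P a) (P b) (ℭ.pair a b) J +
        ∫⁻ p in Prod.snd ⁻¹' Y,
          kernelDistWithin (P b) (P c) (ℭ.pair b c) (hJ.2 hs) hsc (hJ.2 ht) htc p ∂qb := by
  -- notation: the three integrands `K` and the three distance terms `D`
  set Kac : (P a).flow.Slice ⟨t, (ℭ.dom_subset a (hJ.1 ht)).1⟩ ×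
      (P c).flow.Slice ⟨t, (ℭ.dom_subset c htc).1⟩ → ℝ≥0∞ := fun p ↦
    kernelDistWithin (P a) (P c) (ℭ.pair a c) (hJ.1 hs) hsc (hJ.1 ht) htc p
  set Kbc : (P b).flow.Slice ⟨t, (ℭ.dom_subset b (hJ.2 ht)).1⟩ ×
      (P c).flow.Slice ⟨t, (ℭ.dom_subset c htc).1⟩ → ℝ≥0∞ := fun p ↦
    kernelDistWithin (P b) (P c) (ℭ.pair b c) (hJ.2 hs) hsc (hJ.2 ht) htc p
  set Kab : (P a).flow.Slice ⟨t, (ℭ.dom_subset a (hJ.1 ht)).1⟩ ×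
      (P b).flow.Slice ⟨t, (ℭ.dom_subset b (hJ.2 ht)).1⟩ → ℝ≥0∞ := fun p ↦
    kernelDistWithin (P a) (P b) (ℭ.pair a b) (hJ.1 hs) (hJ.2 hs) (hJ.1 ht) (hJ.2 ht) p
  set Dac : (P a).flow.Slice ⟨t, (ℭ.dom_subset a (hJ.1 ht)).1⟩ ×
      (P c).flow.Slice ⟨t, (ℭ.dom_subset c htc).1⟩ → ℝ≥0∞ := fun p ↦
    edist (ℭ.φ a t (hJ.1 ht) p.1) (ℭ.φ c t htc p.2)
  set Dbc : (P b).flow.Slice ⟨t, (ℭ.dom_subset b (hJ.2 ht)).1⟩ ×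
      (P c).flow.Slice ⟨t, (ℭ.dom_subset c htc).1⟩ → ℝ≥0∞ := fun p ↦
    edist (ℭ.φ b t (hJ.2 ht) p.1) (ℭ.φ c t htc p.2)
  set Dab : (P a).flow.Slice ⟨t, (ℭ.dom_subset a (hJ.1 ht)).1⟩ ×
      (P b).flow.Slice ⟨t, (ℭ.dom_subset b (hJ.2 ht)).1⟩ → ℝ≥0∞ := fun p ↦
    edist (ℭ.φ a t (hJ.1 ht) p.1) (ℭ.φ b t (hJ.2 ht) p.2)
  have hKac : Measurable Kac :=
    measurable_kernelDistWithin hHa hHc (ℭ.pair a c) (hJ.1 hs) hsc (hJ.1 ht) htc hst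
  have hKbc : Measurable Kbc :=
    measurable_kernelDistWithin hHb hHc (ℭ.pair b c) (hJ.2 hs) hsc (hJ.2 ht) htc hst
  have hKab : Measurable Kab :=
    measurable_kernelDistWithin hHa hHb (ℭ.pair a b) (hJ.1 hs) (hJ.2 hs) (hJ.1 ht) (hJ.2 ht) hst
  have hφa := (ℭ.isometry a t (hJ.1 ht)).continuous
  have hφb := (ℭ.isometry b t (hJ.2 ht)).continuous
  have hφc := (ℭ.isometry c t htc).continuous
  have hDac : Measurable Dac :=
    ((hφa.comp continuous_fst).edist (hφc.comp continuous_snd)).measurable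
  have hDbc : Measurable Dbc :=
    ((hφb.comp continuous_fst).edist (hφc.comp continuous_snd)).measurable
  have hDab : Measurable Dab :=
    ((hφa.comp continuous_fst).edist (hφb.comp continuous_snd)).measurable
  -- glue `q_a` and the swapped `q_b` along the common marginal `μ^c_t`
  haveI := hqb.1
  have hqb' : IsCoupling ((P c).μ ⟨t, (ℭ.dom_subset c htc).1⟩)
      ((P b).μ ⟨t, (ℭ.dom_subset b (hJ.2 ht)).1⟩) (qb.map Prod.swap) :=
    ⟨Measure.isProbabilityMeasure_map measurable_swap.aemeasurable,
      by rw [Measure.fst_map_swap]; exact hqb.2.2, by rw [Measure.snd_map_swap]; exact hqb.2.1⟩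
  obtain ⟨γ, hγP, hγa, hγb⟩ := hqa.exists_glue hqb'
  haveI := hγP
  have hπa : Measurable fun x : (P c).flow.Slice ⟨t, (ℭ.dom_subset c htc).1⟩ ×
      ((P a).flow.Slice ⟨t, (ℭ.dom_subset a (hJ.1 ht)).1⟩ ×
        (P b).flow.Slice ⟨t, (ℭ.dom_subset b (hJ.2 ht)).1⟩) ↦ (x.2.1, x.1) :=
    measurable_snd.fst.prodMk measurable_fst
  have hπ₀ : Measurable fun x : (P c).flow.Slice ⟨t, (ℭ.dom_subset c htc).1⟩ ×
      ((P a).flow.Slice ⟨t, (ℭ.dom_subset a (hJ.1 ht)).1⟩ ×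
        (P b).flow.Slice ⟨t, (ℭ.dom_subset b (hJ.2 ht)).1⟩) ↦ (x.1, x.2.2) :=
    measurable_fst.prodMk measurable_snd.snd
  have hπb : Measurable fun x : (P c).flow.Slice ⟨t, (ℭ.dom_subset c htc).1⟩ ×
      ((P a).flow.Slice ⟨t, (ℭ.dom_subset a (hJ.1 ht)).1⟩ ×
        (P b).flow.Slice ⟨t, (ℭ.dom_subset b (hJ.2 ht)).1⟩) ↦ (x.2.2, x.1) :=
    measurable_snd.snd.prodMk measurable_fst
  -- the `(b, c)`-marginal of `γ` is `q_b`
  have hγb' : γ.map (fun x ↦ (x.2.2, x.1)) = qb := by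
    have e : (fun x : (P c).flow.Slice ⟨t, (ℭ.dom_subset c htc).1⟩ ×
        ((P a).flow.Slice ⟨t, (ℭ.dom_subset a (hJ.1 ht)).1⟩ ×
          (P b).flow.Slice ⟨t, (ℭ.dom_subset b (hJ.2 ht)).1⟩) ↦ (x.2.2, x.1)) =
        Prod.swap ∘ fun x ↦ (x.1, x.2.2) := rfl
    rw [e, ← Measure.map_map measurable_swap hπ₀, hγb,
      Measure.map_map measurable_swap measurable_swap, Prod.swap_swap_eq, Measure.map_id]
  -- the `(a, b)`-marginal `q̃` of `γ` couples `μ^a_t, μ^b_t`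
  have hqab : IsCoupling ((P a).μ ⟨t, (ℭ.dom_subset a (hJ.1 ht)).1⟩)
      ((P b).μ ⟨t, (ℭ.dom_subset b (hJ.2 ht)).1⟩) (γ.map Prod.snd) := by
    refine ⟨Measure.isProbabilityMeasure_map measurable_snd.aemeasurable, ?_, ?_⟩
    · rw [Measure.fst, Measure.map_map measurable_fst measurable_snd, ← hqa.2.1, ← hγa, Measure.fst,
        Measure.map_map measurable_fst hπa]
      rfl
    · rw [Measure.snd, Measure.map_map measurable_snd measurable_snd, ← hqb.2.1, ← hγb',
        Measure.fst, Measure.map_map measurable_fst hπb]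
      rfl
  -- (5.29): Lemma 5.19 for `q̃`, whose displacement is controlled by those of `q_a`, `q_b`
  have h519 := lintegral_kernelDistWithin_le_add_two_mul_fDistWithin hHa hHb (ℭ.pair a b) hJ hs ht
    hst hqab
  have hDab_le : ∫⁻ p, Dab p ∂(γ.map Prod.snd) ≤ ∫⁻ p, Dac p ∂qa + ∫⁻ p, Dbc p ∂qb := by
    calc ∫⁻ p, Dab p ∂(γ.map Prod.snd) = ∫⁻ x, Dab x.2 ∂γ := lintegral_map hDab measurable_snd
      _ ≤ ∫⁻ x, (Dac (x.2.1, x.1) + Dbc (x.2.2, x.1)) ∂γ := lintegral_mono fun x ↦ by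
          show edist (ℭ.φ a t (hJ.1 ht) x.2.1) (ℭ.φ b t (hJ.2 ht) x.2.2) ≤
            edist (ℭ.φ a t (hJ.1 ht) x.2.1) (ℭ.φ c t htc x.1) +
              edist (ℭ.φ b t (hJ.2 ht) x.2.2) (ℭ.φ c t htc x.1)
          rw [edist_comm (ℭ.φ b t (hJ.2 ht) x.2.2)]
          exact edist_triangle _ _ _
      _ = ∫⁻ x, Dac (x.2.1, x.1) ∂γ + ∫⁻ x, Dbc (x.2.2, x.1) ∂γ :=
          lintegral_add_left (hDac.comp hπa) _
      _ = ∫⁻ p, Dac p ∂qa + ∫⁻ p, Dbc p ∂qb := by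
          rw [← hγa, ← hγb', lintegral_map hDac hπa, lintegral_map hDbc hπb]
  -- (5.30): integrate the pointwise triangle inequality in `Z_s` over `𝒳^a_t × 𝒳^b_t × Y`
  calc ∫⁻ p in Prod.snd ⁻¹' Y, Kac p ∂qa
      = ∫⁻ x in Prod.fst ⁻¹' Y, Kac (x.2.1, x.1) ∂γ := by
        rw [← hγa, setLIntegral_map (measurable_snd hY) hKac hπa]
        rfl
    _ ≤ ∫⁻ x in Prod.fst ⁻¹' Y, (Kab x.2 + Kbc (x.2.2, x.1)) ∂γ :=
        lintegral_mono fun x ↦ kernelDistWithin_pair_le P ℭ (hJ.1 hs) (hJ.2 hs) hsc (hJ.1 ht)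
          (hJ.2 ht) htc hst x.2.1 x.2.2 x.1
    _ = ∫⁻ x in Prod.fst ⁻¹' Y, Kab x.2 ∂γ + ∫⁻ x in Prod.fst ⁻¹' Y, Kbc (x.2.2, x.1) ∂γ :=
        lintegral_add_left (hKab.comp measurable_snd) _
    _ ≤ ∫⁻ x, Kab x.2 ∂γ + ∫⁻ x in Prod.fst ⁻¹' Y, Kbc (x.2.2, x.1) ∂γ :=
        add_le_add (setLIntegral_le_lintegral _ _) le_rfl
    _ = ∫⁻ p, Kab p ∂(γ.map Prod.snd) + ∫⁻ p in Prod.snd ⁻¹' Y, Kbc p ∂qb := by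
        rw [lintegral_map hKab measurable_snd, ← hγb',
          setLIntegral_map (measurable_snd hY) hKbc hπb]
        rfl
    _ ≤ ∫⁻ p, Dab p ∂(γ.map Prod.snd) + 2 * fDistWithin (P a) (P b) (ℭ.pair a b) J +
          ∫⁻ p in Prod.snd ⁻¹' Y, Kbc p ∂qb := add_le_add h519 le_rfl
    _ ≤ ∫⁻ p, Dac p ∂qa + ∫⁻ p, Dbc p ∂qb + 2 * fDistWithin (P a) (P b) (ℭ.pair a b) J +
          ∫⁻ p in Prod.snd ⁻¹' Y, Kbc p ∂qb :=
        add_le_add (add_le_add hDab_le le_rfl) le_rfl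

end MetricFlowPair

/-! ### Uniform convergence on compact sets of equi-Lipschitz functions -/

/-- **Equi-Lipschitz functions converging to `0` pointwise converge to `0` uniformly on compact
sets** (in `[0, ∞]`): if `f_k(z) ≤ f_k(z') + L d(z, z')` for all `k, z, z'` with `L < ∞` and
`f_k(z) → 0` for every `z`, then for every compact `Y` and `ε > 0`, `f_k ≤ ε` on `Y` for large `k`
(finite `δ`-net of `Y` with `(L + 1) δ = ε / 2`). [folklore] -/
theorem exists_forall_ge_forall_mem_le_of_isCompact {X : Type*} [PseudoEMetricSpace X]
    {f : ℕ → X → ℝ≥0∞} {L : ℝ≥0∞} (hL : L ≠ ∞)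
    (hlip : ∀ k z z', f k z ≤ f k z' + L * edist z z')
    (hpt : ∀ z, Tendsto (fun k ↦ f k z) atTop (𝓝 0)) {Y : Set X} (hY : IsCompact Y)
    {ε : ℝ≥0∞} (hε : 0 < ε) : ∃ k₀, ∀ k ≥ k₀, ∀ z ∈ Y, f k z ≤ ε := by
  have hε2 : 0 < ε / 2 := ENNReal.half_pos hε.ne'
  have hL1 : L + 1 ≠ 0 := (lt_of_lt_of_le zero_lt_one le_add_self).ne'
  have hL1' : L + 1 ≠ ∞ := ENNReal.add_ne_top.2 ⟨hL, ENNReal.one_ne_top⟩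
  set δ : ℝ≥0∞ := ε / 2 / (L + 1) with hδ
  have hδ0 : 0 < δ := ENNReal.div_pos hε2.ne' hL1'
  have hLδ : (L + 1) * δ = ε / 2 := ENNReal.mul_div_cancel hL1 hL1'
  obtain ⟨T, -, hTf, hcover⟩ := EMetric.totallyBounded_iff'.1 hY.totallyBounded δ hδ0
  have hev : ∀ᶠ k in atTop, ∀ y ∈ T, f k y ≤ ε / 2 :=
    hTf.eventually_all.2 fun y _ ↦ (hpt y).eventually_le_const hε2
  obtain ⟨k₀, hk₀⟩ := eventually_atTop.1 hev
  refine ⟨k₀, fun k hk z hz ↦ ?_⟩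
  obtain ⟨y, hyT, hzy⟩ : ∃ y ∈ T, z ∈ Metric.eball y δ := by
    simpa only [mem_iUnion, exists_prop] using hcover hz
  rw [Metric.mem_eball] at hzy
  calc f k z ≤ f k y + L * edist z y := hlip k z y
    _ ≤ ε / 2 + (L + 1) * δ := add_le_add (hk₀ k hk y hyT) (mul_le_mul' le_self_add hzy.le)
    _ = ε := by rw [hLδ, ENNReal.add_halves]

/-! ### (5.31), abstract form -/

/-- **Bamler 2023, Lemma 5.20, (5.31), abstract form.** Let `φ_k : X_k → Z`, `φ_∞ : X_∞ → Z` be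
isometric embeddings and `K_k : X_k × X_∞ → [0, ∞]` kernels that are `1`-Lipschitz in each variable,
such that every `z ∈ X_∞` is the limit `φ_k(y_k) → φ_∞(z)` of a sequence along which
`K_k(y_k, z) → 0`. Then for every compact `Y ⊆ X_∞` and `ε > 0`, for large `k`,
`K_k(y, z) ≤ d^Z(φ_k y, φ_∞ z) + ε` for all `y ∈ X_k`, `z ∈ Y`. (In the source this is proved by
contradiction after passing to subsequences; here: the functions
`f_k(z) := sup_y (K_k(y, z) ∸ d^Z(φ_k y, φ_∞ z))` satisfy `f_k(z) ≤ f_k(z') + 2 d(z, z')`, and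
`f_k(z) ≤ K_k(y_k, z) + d^Z(φ_∞ z, φ_k y_k) → 0` by the Lipschitz bound in the first variable, so
`f_k → 0` uniformly on `Y`, `exists_forall_ge_forall_mem_le_of_isCompact`.)
[cite: Bamler2023, §5.4, Lemma 5.20 (arXiv v1 Lemma 121), (5.31)] -/
theorem exists_forall_ge_kernel_le_edist_add {Z Xinf : Type*} [PseudoEMetricSpace Z]
    [PseudoEMetricSpace Xinf] {X : ℕ → Type*} [∀ k, PseudoEMetricSpace (X k)]
    {φ : ∀ k, X k → Z} {φinf : Xinf → Z} (hφ : ∀ k, Isometry (φ k)) (hφinf : Isometry φinf)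
    (K : ∀ k, X k → Xinf → ℝ≥0∞) (hK₁ : ∀ k y y' z, K k y z ≤ K k y' z + edist y y')
    (hK₂ : ∀ k y z z', K k y z ≤ K k y z' + edist z z')
    (h : ∀ z, ∃ x : ∀ k, X k, Tendsto (fun k ↦ φ k (x k)) atTop (𝓝 (φinf z)) ∧
      Tendsto (fun k ↦ K k (x k) z) atTop (𝓝 0))
    {Y : Set Xinf} (hY : IsCompact Y) {ε : ℝ≥0∞} (hε : 0 < ε) :
    ∃ k₀, ∀ k ≥ k₀, ∀ (y : X k), ∀ z ∈ Y, K k y z ≤ edist (φ k y) (φinf z) + ε := by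
  -- `f_k(z) := sup_y (K_k(y, z) ∸ d^Z(φ_k y, φ_∞ z))`
  set f : ℕ → Xinf → ℝ≥0∞ := fun k z ↦ ⨆ y, (K k y z - edist (φ k y) (φinf z)) with hf
  -- `f_k(z) ≤ f_k(z') + 2 d(z, z')`
  have hf_lip : ∀ k z z', f k z ≤ f k z' + 2 * edist z z' := by
    intro k z z'
    refine iSup_le fun y ↦ ?_
    have h1 : K k y z' - edist (φ k y) (φinf z') ≤ f k z' :=
      le_iSup (fun y ↦ K k y z' - edist (φ k y) (φinf z')) y
    have h2 : edist (φ k y) (φinf z') ≤ edist (φ k y) (φinf z) + edist z z' :=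
      calc edist (φ k y) (φinf z') ≤ edist (φ k y) (φinf z) + edist (φinf z) (φinf z') :=
          edist_triangle _ _ _
        _ = edist (φ k y) (φinf z) + edist z z' := by rw [hφinf.edist_eq]
    rw [tsub_le_iff_left]
    calc K k y z ≤ K k y z' + edist z z' := hK₂ k y z z'
      _ ≤ edist (φ k y) (φinf z') + (K k y z' - edist (φ k y) (φinf z')) + edist z z' :=
          add_le_add le_add_tsub le_rfl
      _ ≤ edist (φ k y) (φinf z) + edist z z' + f k z' + edist z z' :=
          add_le_add (add_le_add h2 h1) le_rfl
      _ = edist (φ k y) (φinf z) + (f k z' + 2 * edist z z') := by ring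
  -- `f_k(z) → 0`
  have hf_pt : ∀ z, Tendsto (fun k ↦ f k z) atTop (𝓝 0) := by
    intro z
    obtain ⟨x, hx, hKx⟩ := h z
    have hx' : Tendsto (fun k ↦ edist (φ k (x k)) (φinf z)) atTop (𝓝 0) :=
      tendsto_iff_edist_tendsto_0.1 hx
    have hsum : Tendsto (fun k ↦ K k (x k) z + edist (φ k (x k)) (φinf z)) atTop (𝓝 0) := by
      simpa only [add_zero] using hKx.add hx'
    refine tendsto_of_tendsto_of_tendsto_of_le_of_le tendsto_const_nhds hsum (fun _ ↦ zero_le)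
      fun k ↦ iSup_le fun y ↦ ?_
    rw [tsub_le_iff_left]
    calc K k y z ≤ K k (x k) z + edist y (x k) := hK₁ k y (x k) z
      _ = K k (x k) z + edist (φ k y) (φ k (x k)) := by rw [(hφ k).edist_eq]
      _ ≤ K k (x k) z + (edist (φ k y) (φinf z) + edist (φinf z) (φ k (x k))) :=
          add_le_add le_rfl (edist_triangle _ _ _)
      _ = edist (φ k y) (φinf z) + (K k (x k) z + edist (φ k (x k)) (φinf z)) := by
          rw [edist_comm (φinf z)]
          ring
  obtain ⟨k₀, hk₀⟩ := exists_forall_ge_forall_mem_le_of_isCompact ENNReal.ofNat_ne_top hf_lip hf_pt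
    hY hε
  refine ⟨k₀, fun k hk y z hz ↦ ?_⟩
  calc K k y z ≤ edist (φ k y) (φinf z) + (K k y z - edist (φ k y) (φinf z)) := le_add_tsub
    _ ≤ edist (φ k y) (φinf z) + f k z :=
        add_le_add le_rfl (le_iSup (fun y ↦ K k y z - edist (φ k y) (φinf z)) y)
    _ ≤ edist (φ k y) (φinf z) + ε := add_le_add le_rfl (hk₀ k hk z hz)

end Literature.Geometry.Riemannian

end
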